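import Summits.QuantumAdvantage.QuantumAdvantage.Theorems.PromiseLiftPlLiftStubCertifyK8
import Summits.QuantumAdvantage.QuantumAdvantage.Theorems.WhiteBoxWalkWbwThesis
import Summits.QuantumAdvantage.QuantumAdvantage.Theorems.PromiseLiftPlLiftStubCanonicalLiftSiegeK3
import Literature.Computability.Cryptography.OneMessageProofSystem

/-!
# STUB-IDEAS k1 (companion of STUB-IDEAS-stub_certified_thesis-1.md) — helper-lemma signatures for `stub_certified_thesis : WbwCertifiedThesis`
(crux stmt-QuantumAdvantage-0250 `PlLift`, line `certified-canonical-lift`). Elaboration sanity only: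
every `sorry` below is a PROPOSED helper lemma for a stub prover, not a claim.
-/

set_option linter.dupNamespace false

noncomputable section

namespace Summit.QuantumAdvantage.QuantumAdvantage.Cruxes.PlLift.CertifiedCanonicalLift.StubIdeasK1

open Filter Asymptotics
open Literature.Computability.Complexity Literature.Computability.Cryptography
open Summit.QuantumAdvantage.QuantumAdvantage.Theorems (FactoringAssumption)
open Summit.QuantumAdvantage.QuantumAdvantage.Theorems.WhiteBoxWalk (genPQ ansPQ prePQ isOneWay_genPQ clauseQ_genPQ)

/-- The classical-hardness clause (C), shared verbatim by `WbwThesis`, `WbwCanonicalThesis`,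
`WbwCertifiedThesis` (abbreviation for this sketch only). -/
def ClauseC (gen ans : List Bool → List Bool) : Prop :=
  ∀ A : RandAlg (List Bool) (List Bool), IsPPT A id →
    SuperpolynomialDecay atTop (fun n : ℕ => (n : ℝ)) (fun n : ℕ =>
      uniformAvg n fun s => A.pr id (boolPair (Computability.unaryEncodeNat n) (gen s)) {y | ans s <+: y})

/-! ## Plan A — TREE MATCH: the factoring benchmark line of crux `WbwThesis` carries X_cert -/

/-- A0 (S–M, provable now): the (C)-half of `stub_bridge` in NON-existential form (same truncation
adversary `Bridge.isPPT_of_run_eq_take` / `Bridge.run_eq_of_prefix`). -/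
theorem clauseC_of_isOneWay {gen pre : List Bool → List Bool} (hgen : IsOneWay gen)
    (hpre : ∀ s, gen (pre s) = gen s) (hlen : ∀ s, (pre s).length = s.length)
    (hle : ∀ s, s.length ≤ (gen s).length) :
    ClauseC gen (fun s => pre s ++ List.replicate ((gen s).length - s.length) false) := by
  sorry

/-- A1 (M, provable now): clause (Q) for the factoring witness is CANONICAL ON EVERY INPUT —
`clauseQ_genPQ`'s proof re-run with a normalising pre-processor and a `fit |x|` post-processor
(Shor `factoring_mem_FBQP_holds` is total; `Assemble.parse_rawE` is junk-invariant). -/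
theorem canonicalQ_genPQ : ∃ (a : List Bool → List Bool) (F : QCircuitFamily cliffordT),
    F.IsOracleFree ∧ F.IsUniform ∧ (∀ w, a (genPQ w) = ansPQ w) ∧ (∀ x, (a x).length = x.length) ∧
    ∀ x, (2 / 3 : ℝ) ≤ F.kernelProb 0 x {y | a x <+: y} := by
  sorry

/-- A1' (M, fallback): the same on an `FP`-decidable superset `{V = true}` of the range of `genPQ`
(V := "is a well-formed `rawE strE` codeword"), which is all X_cert asks. -/
theorem certifiedQ_genPQ : ∃ (a : List Bool → List Bool) (V : List Bool → Bool) (F : QCircuitFamily cliffordT),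
    (fun x => [V x]) ∈ FP ∧ (∀ w, V (genPQ w) = true) ∧
    F.IsOracleFree ∧ F.IsUniform ∧ (∀ w, a (genPQ w) = ansPQ w) ∧ (∀ x, (a x).length = x.length) ∧
    ∀ x, V x = true → (2 / 3 : ℝ) ≤ F.kernelProb 0 x {y | a x <+: y} := by
  sorry

/-- A2 (S, packaging): `gen := genPQ` (`(isOneWay_genPQ hF).1`), `ans := ansPQ`, `p := X`, `a`/`F`
from A1, (C) from A0 with `pre := prePQ` (`stub_canon`). -/
theorem wbwCanonicalThesis_of_factoringAssumption (hF : FactoringAssumption) : WbwCanonicalThesis := by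
  sorry

/-- A3 (XS): `V := fun _ => true`, `const_mem_FP [true]`. -/
theorem wbwCertifiedThesis_of_canonical (h : WbwCanonicalThesis) : WbwCertifiedThesis := by
  obtain ⟨gen, ans, a, p, hgen, hag, hlen, ⟨F, hF, hU, hQ⟩, hC⟩ := h
  exact ⟨gen, ans, a, fun _ => true, p, hgen, const_mem_FP [true], fun _ => rfl, hag, hlen,
    ⟨F, hF, hU, fun x _ => hQ x⟩, hC⟩

/-- ASSEMBLY of Plan A: the stub at the benchmark grade of crux `WbwThesis` (only `FactoringAssumption`,
`@[conjecture]`, remains). -/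
theorem wbwCertifiedThesis_of_factoringAssumption (hF : FactoringAssumption) : WbwCertifiedThesis :=
  wbwCertifiedThesis_of_canonical (wbwCanonicalThesis_of_factoringAssumption hF)

/-- … hence the whole line composes end to end under the factoring assumption (stubs 2–3 landed). -/
example (hF : FactoringAssumption) : QuantumAdvantage :=
  -- the landed stub 3 (SiegeK3) states its own verbatim copy of `WbwCanonicalThesis`; the two are defeq
  Summit.QuantumAdvantage.QuantumAdvantage.Theorems.PlLift.CertifiedCanonicalLift.SiegeK3.stub_canonical_lift
    (stub_certify (wbwCertifiedThesis_of_factoringAssumption hF))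

/-! ## Plan C — NOTATION MATCH (Gat–Goldwasser pseudo-determinism; Grollmann–Selman certification) -/

/-- C0: certified and everywhere-canonical planting are the SAME proposition (with landed `stub_certify`). -/
theorem wbwCertifiedThesis_iff_canonical : WbwCertifiedThesis ↔ WbwCanonicalThesis :=
  ⟨stub_certify, wbwCertifiedThesis_of_canonical⟩

/-- C1 (S–M): heavy-prefix form — the answer map `a` need not be exhibited; a prefix of the prescribed
length carried with probability `≥ 2/3` is unique (`kernelProb_add_kernelProb_le_one`), so `a` is
definable by choice. -/
theorem wbwCertifiedThesis_iff_heavy : WbwCertifiedThesis ↔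
    ∃ (gen ans : List Bool → List Bool) (V : List Bool → Bool) (p : Polynomial ℕ),
      PolyTimeComputable id id gen ∧ (fun x => [V x]) ∈ FP ∧ (∀ s, V (gen s) = true) ∧
      (∀ s, (ans s).length = p.eval (gen s).length) ∧
      (∃ F : QCircuitFamily cliffordT, F.IsOracleFree ∧ F.IsUniform ∧
        (∀ s, (2 / 3 : ℝ) ≤ F.kernelProb 0 (gen s) {y | ans s <+: y}) ∧
        ∀ x, V x = true → ∃ w : List Bool, w.length = p.eval x.length ∧
          (2 / 3 : ℝ) ≤ F.kernelProb 0 x {y | w <+: y}) ∧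
      ClauseC gen ans := by
  sorry

/-- C2 (S–M): Grollmann–Selman form — the route target X plus an `FP`-decidable RANGE already gives
X_cert (answers are unique on fibres of `gen` by the 2/3-prefix argument of `wbwSearchToPromise_proof`). -/
theorem wbwCertifiedThesis_of_range
    (h : ∃ (gen ans : List Bool → List Bool) (V : List Bool → Bool), PolyTimeComputable id id gen ∧
      (fun x => [V x]) ∈ FP ∧ (∀ x, V x = true ↔ x ∈ Set.range gen) ∧
      (∃ p : Polynomial ℕ, ∀ s, (ans s).length = p.eval (gen s).length) ∧
      (∃ F : QCircuitFamily cliffordT, F.IsOracleFree ∧ F.IsUniform ∧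
        ∀ s, (2 / 3 : ℝ) ≤ F.kernelProb 0 (gen s) {y | ans s <+: y}) ∧
      ClauseC gen ans) : WbwCertifiedThesis := by
  sorry

/-! ## Plan B — ANALOGY TRANSFER: the VRF-from-NIWI "2-of-3 commit-and-prove" compiler (Bitansky 2017) -/

/-- B1 (M, provable now, crypto-free): pseudo-deterministic amplification under UNIQUE PUBLIC
VERIFIABILITY + a FIND-PROBABILITY DICHOTOMY on the certified set `T` (`PolyCopies.kernelProb_ge_of_exists'`
for the walkable branch, `PolyCopiesIdx.kernelProb_segments_ge` for the dead branch, read-out à la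
`PolyCopiesIdx.anyF`). -/
theorem psd_of_verifiable_dichotomy
    (acc : List Bool → List Bool → Bool) (hacc : (fun z => [acc (Brick.fstF z) (Brick.sndF z)]) ∈ FP)
    (huniq : ∀ x v v', acc x v = true → acc x v' = true → v = v')
    (ℓ q : Polynomial ℕ) (hℓ : ∀ x v, acc x v = true → v.length = ℓ.eval x.length)
    (T : Set (List Bool)) {F₀ : QCircuitFamily cliffordT} (hF₀ : F₀.IsOracleFree) (hU₀ : F₀.IsUniform)
    (hdich : ∀ x ∈ T,
      (1 : ℝ) / (q.eval x.length + 1) ≤ F₀.kernelProb 0 x {y | ∃ v, acc x v = true ∧ v <+: y} ∨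
        F₀.kernelProb 0 x {y | ∃ v, acc x v = true ∧ v <+: y} ≤ (1 : ℝ) / (6 * (q.eval x.length + 1))) :
    ∃ (a : List Bool → List Bool) (F : QCircuitFamily cliffordT), F.IsOracleFree ∧ F.IsUniform ∧
      (∀ x, (a x).length = ℓ.eval x.length + 1) ∧
      (∀ x v, acc x v = true →
        (1 : ℝ) / (q.eval x.length + 1) ≤ F₀.kernelProb 0 x {y | ∃ v, acc x v = true ∧ v <+: y} →
          a x = true :: v) ∧
      ∀ x ∈ T, (2 / 3 : ℝ) ≤ F.kernelProb 0 x {y | a x <+: y} := by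
  sorry

/-- NIWI proofs for all of NP exist (plain model, perfect soundness; Bitansky–Paneth 2015 from iO +
one-way permutations; BOV07; GOS06) — the extra assumption of the certification layer, typed in the
landed vocabulary of `OneMessageProofSystem.lean` (statement only; to be a named fact / hypothesis). -/
def NIWIForNP : Prop :=
  ∀ R : List Bool → List Bool → Prop, IsNPRelation R →
    ∃ PS : OneMessageProofSystem, PS.IsEfficient ∧ PS.IsPerfectlyComplete R ∧ PS.IsPerfectlySound R ∧
      PS.IsNIWI R

/-- B2 (hypothesis-grade, XL — the Shor-neutral ENGINE of the stub, typed): the BPR15 §5.1 bundle of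
the route's `WbwEngine` plus plain-model NIWI gives certified planting. Not provable today (it contains
the rank-2 chain of crux `WbwObfuscatedGluedTrees`); recorded so that the re-cut can carry it as the
analogue of `WbwEngine`. -/
def WbwCertEngine : Prop :=
  (∃ ε : ℝ, 0 < ε ∧ ε < 1 ∧ SubexpIOExist ε ∧
      TDSecurePuncturablePRFExist (fun κ => (2 : ℝ) ^ ((κ : ℝ) ^ ε)) (fun κ => (2 : ℝ) ^ (-((κ : ℝ) ^ ε))) id id ∧
      ∃ f : List Bool → List Bool, IsOneWay f ∧ Function.Injective f) →
    NIWIForNP → WbwCertifiedThesis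

end Summit.QuantumAdvantage.QuantumAdvantage.Cruxes.PlLift.CertifiedCanonicalLift.StubIdeasK1

end
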